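import Mathlib
import Literature.Analysis.FluidPDE.Tao2016AveragedNS.ShiftSetCascadeFlows
import Summits.NavierStokesRegularity.NavierStokesRegularity.Theorems.TaoLadderRungTwoFlatCertificateGlueCheckerFieldOn
import Summits.NavierStokesRegularity.NavierStokesRegularity.Theorems.TaylorModelRungThreeCertificateIntervalDJetsArray
import HarnessLib

/-!
# Certificate glue on a shift set `𝕊`, XXIV-b: THE CHECKER'S FIELD, ARRAY FORM — `pqBoxA`, the `Array IntervalD` twin of
  the window field `PQcN`, its soundness `isFieldEnclosureA_pqBoxA` in the sense of pub-ns-dss's array jet pipeline, and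
  the materialised-jet corollary `mem_taylorJet_pqLevels` (helper for items stmt-NavierStokesRegularity-22987
  `FlatGapCertificatesV2` (crux K_A♭ of route TaoLadderRungTwoFlat) and stmt-24295 K_A₂(64); cell harvest/h2-tao-ladder,
  p1 g15; CHECKER-SPEC-v3 §3 (i))

Glue XXIV gave the function-level twin `pqBox` (`IsFieldEnclosure`). pub-ns-dss's executable pipeline
(`…TaylorModelCert.IntervalD.jetLevelsA` / `varJetLevelsA` / `polyLevelsA` / interval matrix products) is ARRAY-coded with
the ℕ-indexed reader convention `rd : V → ℕ → ℝ` and the predicate `IsFieldEnclosureA rd Q n QBA`. This file is the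
adapter: `rdN` (read a `Fin n`-vector at `c : ℕ`, junk `0` beyond `n`), `pqBoxA` (`Array.ofFn` of `pqBox` on `aget`-readers),
`isFieldEnclosureA_pqBoxA`, and `mem_taylorJet_pqLevels` — the Taylor jets `taylorJet (PQcN …) y k` of every point `y` of a
box `Y` lie coordinatewise in `jetLevelsA n pqBoxA prec Y K` (their `mem_jet_of_jetLevelsA`). From here the successor's step
checker evaluates `TPoly` / `VPoly` by `polyLevelsA` and the frame clauses by the interval matrix kernel, unchanged.

HONEST FRAMING: Tao-type MODEL lattices (Tao 2016 §4/§6 vocabulary, shift-set parametrised); interval-arithmetic soundness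
about an explicit polynomial field — no certificate data, nothing certified, no stub closed, nothing about the Navier–Stokes
equations.
-/

-- the sub-problem namespace repeats the summit name by design (D-0017)
set_option linter.dupNamespace false

namespace Summit.NavierStokesRegularity.NavierStokesRegularity.Theorems

open Set Finset Literature.Analysis.FluidPDE Literature.Analysis.FluidPDE.TaoCascade
open Summit.NavierStokesRegularity.NavierStokesRegularity.Theorems.TaylorModelCert
open Summit.NavierStokesRegularity.NavierStokesRegularity.Theorems.TaylorModelReadout

namespace CertificateGlueOn

variable {m : ℕ} {Kb Ka : ℤ} {ω : Fin m → ℤ → ℝ}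

/-- The ℕ-indexed reader of a `Fin n`-vector (junk `0` beyond `n`) — pub-ns-dss's `rd` convention. [folklore] -/
def rdN {n : ℕ} (v : Fin n → ℝ) (c : ℕ) : ℝ := if h : c < n then v ⟨c, h⟩ else 0

/-- Below `n` the reader is evaluation. [folklore] -/
theorem rdN_of_lt {n : ℕ} (v : Fin n → ℝ) {c : ℕ} (hc : c < n) : rdN v c = v ⟨c, hc⟩ := by
  unfold rdN; rw [dif_pos hc]

/-- **THE ARRAY TWIN OF THE WINDOW FIELD**: `pqBox` on `aget`-readers, tabulated over `Fin (m·W)`. [cite: Tao2016AveragedNS, §4 (4.8); cell certificate format, checker field] -/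
def pqBoxA (Kb Ka : ℤ) (prec : ℕ) (shifts : List (ℤ × ℤ × ℤ))
    (coefB : Fin m → ℤ → Fin m → Fin m → ℤ × ℤ × ℤ → IntervalD) (A B : Array IntervalD) : Array IntervalD :=
  Array.ofFn fun d : Fin (m * winLen Kb Ka) =>
    pqBox Kb Ka prec shifts coefB (fun d' => IntervalD.aget A d') (fun d' => IntervalD.aget B d') d

/-- The array twin has size `m·W`. [folklore] -/
theorem size_pqBoxA (prec : ℕ) (shifts : List (ℤ × ℤ × ℤ))
    (coefB : Fin m → ℤ → Fin m → Fin m → ℤ × ℤ × ℤ → IntervalD) (A B : Array IntervalD) :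
    (pqBoxA Kb Ka prec shifts coefB A B).size = m * winLen Kb Ka := by
  simp only [pqBoxA, Array.size_ofFn]

variable {𝕊 : Finset (ℤ × ℤ × ℤ)} {ε₀ : ℝ} {α : Fin m → Fin m → Fin m → ℤ × ℤ × ℤ → ℝ}
  {shifts : List (ℤ × ℤ × ℤ)} {prec : ℕ} {coefB : Fin m → ℤ → Fin m → Fin m → ℤ × ℤ × ℤ → IntervalD}

/-- **`pqBoxA` IS AN ARRAY INTERVAL EXTENSION OF `PQcN`** (`IsFieldEnclosureA` with the reader `rdN`).
[cite: Tao2016AveragedNS, §4 (4.8); cell certificate format, checker field] -/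
theorem isFieldEnclosureA_pqBoxA (hKb : 0 ≤ Kb) (hKa : 1 ≤ Ka) (hnd : shifts.Nodup)
    (hcoef : CoefBoxOK shifts ε₀ α Kb Ka ω coefB) :
    IntervalD.IsFieldEnclosureA (rdN (n := m * winLen Kb Ka)) (PQcN shifts.toFinset ε₀ α Kb Ka ω) (m * winLen Kb Ka)
      (pqBoxA Kb Ka prec shifts coefB) := by
  intro A B u w _ _ hu hw c hc
  unfold pqBoxA
  rw [IntervalD.aget_ofFn _ hc, rdN_of_lt _ hc]
  refine mem_pqBox hKb hKa hnd hcoef (fun d => ?_) (fun d => ?_) ⟨c, hc⟩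
  · have := hu d d.isLt; rwa [rdN_of_lt _ d.isLt] at this
  · have := hw d d.isLt; rwa [rdN_of_lt _ d.isLt] at this

/-- **MATERIALISED JETS OF THE WINDOW FIELD ARE ENCLOSED**: for `y` with coordinates in the box `Y` (size `m·W`), every
Taylor jet `taylorJet (PQcN …) y k`, `k ≤ K`, lies coordinatewise in level `k` of
`jetLevelsA (m·W) (pqBoxA …) prec Y K` (pub-ns-dss's `mem_jet_of_jetLevelsA`).
[cite: Tao2016AveragedNS, §4 (4.8); cell certificate format, checker field] -/
theorem mem_taylorJet_pqLevels (hKb : 0 ≤ Kb) (hKa : 1 ≤ Ka) (hnd : shifts.Nodup)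
    (hcoef : CoefBoxOK shifts ε₀ α Kb Ka ω coefB) (K : ℕ) {Y : Array IntervalD} (hY : Y.size = m * winLen Kb Ka)
    {y : Fin (m * winLen Kb Ka) → ℝ} (hy : ∀ c < m * winLen Kb Ka, IntervalD.mem (rdN y c) (IntervalD.aget Y c)) :
    ∀ k ≤ K, ∀ c < m * winLen Kb Ka,
      IntervalD.mem (rdN (taylorJet (PQcN shifts.toFinset ε₀ α Kb Ka ω) y k) c)
        (IntervalD.aget (IntervalD.lget (IntervalD.jetLevelsA (m * winLen Kb Ka) (pqBoxA Kb Ka prec shifts coefB) prec Y K)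
          k) c) :=
  IntervalD.mem_jet_of_jetLevelsA (rd := rdN (n := m * winLen Kb Ka)) (Q := PQcN shifts.toFinset ε₀ α Kb Ka ω)
    (T := taylorJet (PQcN shifts.toFinset ε₀ α Kb Ka ω)) (fun _ _ _ => rfl)
    (fun x k c hc => by
      rw [rdN_of_lt _ hc, taylorJet_succ_apply]
      exact Finset.sum_congr rfl fun i _ => by rw [rdN_of_lt _ hc])
    (isFieldEnclosureA_pqBoxA hKb hKa hnd hcoef) prec K hY hy

end CertificateGlueOn

end Summit.NavierStokesRegularity.NavierStokesRegularity.Theorems
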